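import Literature.Topology.FourManifolds.SimplifiedBrokenLefschetzFibration
import HarnessLib

/-!
# The genus of a simplified broken Lefschetz fibration is determined by the map

Topic `Literature/Topology/FourManifolds`, a small PROVED complement to
`SimplifiedBrokenLefschetzFibration.lean` (Baykur–Kamada 2015, §3; Hayano 2011, Def. 2.1/2.3):
in the tree's homological reading of the fibre genus (`H₁(F; ℤ) ≅ ℤ^{2n}`), the genus read at a
regular value is single-valued, hence the lower genus `h` in
`IsSimplifiedBrokenLefschetzFibration o f L h` is an invariant of the MAP `f` alone — it does
not depend on the orientation `o` or on the finite set `L` offered as Lefschetz critical set.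
Consequence used by genus-descent arguments (route SblfDescent of `SmoothPoincare4`): an SBLF of
lower genus `h + 1` is never, re-read with other bookkeeping data, an SBLF of lower genus `h`;
any descent step must change the fibration map.

* `eq_of_nonempty_linearEquiv_fin_fun` — `ℤⁿ ≃ H ≃ ℤᵐ` forces `n = m` (invariant basis number).
* `IsSimplifiedBrokenLefschetzFibration.genus_eq` — two SBLF structures on the same map have the
  same lower genus.
* `IsSimplifiedBrokenLefschetzFibration.not_succ` — an SBLF of lower genus `h + 1` is not one of
  lower genus `h` for any `o'`, `L'`.

Everything is proved; no definition and no named fact is introduced.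
-/

noncomputable section

open scoped Manifold ContDiff Topology

universe u

namespace Literature.Topology.FourManifolds

/-- **Invariant basis number, in the form the genus clauses use**: if an abelian group `H` is
`ℤ`-linearly isomorphic both to `ℤⁿ` and to `ℤᵐ` then `n = m` (compare ranks:
`Module.finrank ℤ (Fin n → ℤ) = n`). [folklore] -/
theorem eq_of_nonempty_linearEquiv_fin_fun {H : Type*} [AddCommGroup H] [Module ℤ H] {n m : ℕ}
    (hn : Nonempty ((Fin n → ℤ) ≃ₗ[ℤ] H)) (hm : Nonempty ((Fin m → ℤ) ≃ₗ[ℤ] H)) : n = m := by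
  obtain ⟨e₁⟩ := hn
  obtain ⟨e₂⟩ := hm
  simpa [Module.finrank_fin_fun] using LinearEquiv.finrank_eq (e₁.trans e₂.symm)

namespace IsSimplifiedBrokenLefschetzFibration

variable {X : Type u} [TopologicalSpace X] [ChartedSpace (EuclideanSpace ℝ (Fin 4)) X]
  [IsManifold (𝓡 4) 1 X] {o o' : SmoothOrientation (𝓡 4) X}
  {f : X → Metric.sphere (0 : EuclideanSpace ℝ (Fin 3)) 1} {L L' : Finset X} {h h' : ℕ}

/-- **The lower genus of an SBLF is determined by the map.**  If `f` is a simplified broken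
Lefschetz fibration of lower genus `h` for some orientation and Lefschetz set, and also of lower
genus `h'` for some other orientation and Lefschetz set, then `h = h'`: a higher-side regular
value of the first structure (genus `h + 1`) is a regular value for the second (regularity is a
property of `f` only), so `h + 1 ∈ {h' + 1, h'}`, and symmetrically `h' + 1 ∈ {h + 1, h}`.
[folklore] -/
theorem genus_eq (hf : IsSimplifiedBrokenLefschetzFibration o f L h)
    (hf' : IsSimplifiedBrokenLefschetzFibration o' f L' h') : h = h' := by
  obtain ⟨y, hy, hyg⟩ := hf.exists_higher
  obtain ⟨y', hy', hyg'⟩ := hf'.exists_higher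
  have h₁ : h + 1 = h' + 1 ∨ h + 1 = h' := by
    rcases (hf'.fibre y hy).2 with h2 | h2
    · exact Or.inl (by simpa using eq_of_nonempty_linearEquiv_fin_fun hyg h2)
    · exact Or.inr (by simpa using eq_of_nonempty_linearEquiv_fin_fun hyg h2)
  have h₂ : h' + 1 = h + 1 ∨ h' + 1 = h := by
    rcases (hf.fibre y' hy').2 with h2 | h2
    · exact Or.inl (by simpa using eq_of_nonempty_linearEquiv_fin_fun hyg' h2)
    · exact Or.inr (by simpa using eq_of_nonempty_linearEquiv_fin_fun hyg' h2)
  omega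

/-- **Genus descent cannot reuse the map**: an SBLF of lower genus `h + 1` is not an SBLF of
lower genus `h` for any orientation `o'` and any Lefschetz set `L'`. [folklore] -/
theorem not_succ (hf : IsSimplifiedBrokenLefschetzFibration o f L (h + 1)) :
    ¬ IsSimplifiedBrokenLefschetzFibration o' f L' h :=
  fun hf' ↦ absurd (hf.genus_eq hf') (Nat.succ_ne_self h)

end IsSimplifiedBrokenLefschetzFibration

end Literature.Topology.FourManifolds

end
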